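/-
Copyright (c) 2026. All rights reserved.
Released under Apache 2.0 license as described in the file LICENSE.
Authors: abc-iut cell, seat abc-iut-L4-t5 (gen 4; block W2-B1, [AbsTopIII] Cor 3.6 at the model).
-/
import Literature.AnabelianGeometry.AbsoluteAnabelian.AbsTopIII.MLFGaloisModelIdRigid
import Literature.AnabelianGeometry.AbsoluteAnabelian.AbsTopIII.BiAnabelianModelProofs
import HarnessLib

/-!
# [AbsTopIII] Prop 3.2 (iv) / Def 3.1 (ii) at the model: `Π_k ⥲ G_k` forces `Π_k` centre-free / slim
# (the pairs of mono-analytic type lie in the id-rigid sub-model)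

S. Mochizuki, *Topics in absolute anabelian geometry III* [MochizukiAbsTopIII2015] (kurims manuscript
`paper:url-5493eb38cbb7`), Def 3.1 (ii) p. 67 ("if [...] the surjection `Π_k ↠ G_k` is an isomorphism,
then we shall refer to the MLF-Galois `T`-pair `(Π ↷ M)` as being of mono-analytic type") and the proof
of Prop 3.2 (iv) p. 72 (centre-freeness "follows immediately from the slimness of `Π`"); [AbsAnab]
Thm 1.1.1 (ii) ("`G_k` is slim"), a THEOREM of the tree.

Proof-only complement (abc-iut-L4-t5, per abc-iut-L4-lead ruling #3g) of abc-iut-L4-t9's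
`MLFGaloisModelIdRigid.lean` (`TFModel.Slim p` — the full subcategory of the model category
`𝒳 = TFModel p` on the pairs with slim `Π_k` — is id-rigid, `TFModel.isIdRigid_slim`; `G_k` is slim,
`TFModel.isSlimGroup_galk`) and `BiAnabelianModelProofs.lean` (`TFModel.monoAnalytic p k`, the model
pair `(G_k ↷ ℚ̄_p)` of mono-analytic type): the hypotheses "`Π_k` slim" / "`Π_k` centre-free" of the
id-rigidity theorems hold at every pair whose `ε_k` is an isomorphism (of groups, resp. of topological
groups) —

* `TFModel.center_galk_eq_bot` — `G_k = Gal(ℚ̄_p/k)` is centre-free;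
* `TFModel.center_eq_bot_of_aug_injective` — if `ε_k : Π_k → G_k` is injective (as for pairs of
  mono-analytic type), `Π_k` is centre-free;
* `TFModel.isSlimGroup_of_aug_injective_isOpenMap` — if `ε_k` is moreover open, i.e. an isomorphism of
  topological groups `Π_k ⥲ G_k`, `Π_k` is slim;
* `TFModel.monoAnalytic_center_eq_bot` — in particular for abc-iut-L4-t9's `monoAnalytic p k` (whose
  membership in `𝒳^slim` itself — `ε_k = id` is open — is abc-iut-L4-t9's `isSlimGroup_monoAnalytic_Pi` /
  `monoAnalyticSlim`, not repeated here).

HONEST FRAMING: refereed pre-IUT material; kernel facts about the cell's MODEL categories; nothing here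
bears on [IUTchIII] Cor. 3.12; typed ≠ discharged except for the theorems of this file.
-/

set_option autoImplicit false

noncomputable section

namespace Literature.AnabelianGeometry.AbsoluteAnabelian.AbsTopIII

open Literature.AlgebraicGeometry.Frobenioids (IsSlimGroup)

variable {p : ℕ} [Fact p.Prime]

namespace TFModel

/-- A slim topological group is centre-free (the centre centralises the open subgroup `⊤`).
[cite: MochizukiFrdI2008, §0 p.13] -/
private theorem center_eq_bot_of_isSlimGroup' {G : Type*} [Group G] [TopologicalSpace G]
    (h : IsSlimGroup G) : Subgroup.center G = ⊥ := by
  rw [eq_bot_iff]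
  intro g hg
  have htop := h.centralizer_eq_bot ⊤ isOpen_univ
  rw [← htop, Subgroup.mem_centralizer_iff]
  intro x _
  exact (Subgroup.mem_center_iff.mp hg) x

/-- **`G_k = Gal(ℚ̄_p/k)` is centre-free** for the base `k` of a model object ([AbsAnab] Thm 1.1.1 (ii):
`G_k` is slim — abc-iut-L4-t9's `TFModel.isSlimGroup_galk` — and slim groups are centre-free).
[cite: MochizukiAbsAnab2004, Thm 1.1.1 (ii) p.6] -/
theorem center_galk_eq_bot (A : TFModel p) : Subgroup.center (PadicAlgCl p ≃ₐ[A.k] PadicAlgCl p) = ⊥ :=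
  center_eq_bot_of_isSlimGroup' A.isSlimGroup_galk

/-- **Pairs "of mono-analytic type" have centre-free `Π_k`**: if `ε_k : Π_k → G_k` is injective (hence
bijective — Def 3.1 (ii): "if [...] the surjection `Π_k ↠ G_k` is an isomorphism [...] of mono-analytic
type"), then `Z(Π_k) ≅ Z(G_k) = 1`; such objects lie in every centre-free part of the model category.
[cite: MochizukiAbsTopIII2015, Definition 3.1 (ii) p.67] -/
theorem center_eq_bot_of_aug_injective (A : TFModel p) (h : Function.Injective A.D.aug) :
    Subgroup.center A.pair.Pi = ⊥ := by
  change Subgroup.center A.D.Pi = ⊥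
  rw [eq_bot_iff]
  intro z hz
  rw [Subgroup.mem_bot]
  apply h
  rw [map_one]
  have hc : A.D.aug z ∈ Subgroup.center (PadicAlgCl p ≃ₐ[A.k] PadicAlgCl p) := by
    rw [Subgroup.mem_center_iff] at hz ⊢
    intro τ
    obtain ⟨g, rfl⟩ := A.D.aug_surjective τ
    rw [← map_mul, ← map_mul, hz g]
  rwa [A.center_galk_eq_bot, Subgroup.mem_bot] at hc

/-- **If `ε_k` is an isomorphism of topological groups `Π_k ⥲ G_k` (injective and open), then `Π_k` is
slim** (slimness of `G_k` transported along `ε_k`); this is the printed situation "of mono-analytic type"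
read with topologies. [cite: MochizukiAbsTopIII2015, Definition 3.1 (ii) p.67] -/
theorem isSlimGroup_of_aug_injective_isOpenMap (A : TFModel p) (h : Function.Injective A.D.aug)
    (ho : IsOpenMap A.D.aug) : IsSlimGroup A.pair.Pi := by
  change IsSlimGroup A.D.Pi
  let e : A.D.Pi ≃ₜ* (PadicAlgCl p ≃ₐ[A.k] PadicAlgCl p) :=
    ContinuousMulEquiv.mk'
      ((Equiv.ofBijective A.D.aug ⟨h, A.D.aug_surjective⟩).toHomeomorphOfContinuousOpen
        A.D.continuous_aug ho)
      (fun x y => map_mul A.D.aug x y)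
  exact isSlimGroup_of_continuousMulEquiv e.symm A.isSlimGroup_galk

/-- The centre of `Π_k` of the mono-analytic model pair is trivial.
[cite: MochizukiAbsTopIII2015, Definition 3.1 (ii) p.67] -/
theorem monoAnalytic_center_eq_bot (k : IntermediateField ℚ_[p] (PadicAlgCl p))
    [FiniteDimensional ℚ_[p] k] : Subgroup.center (monoAnalytic p k).pair.Pi = ⊥ :=
  (monoAnalytic p k).center_eq_bot_of_aug_injective Function.injective_id

end TFModel

end Literature.AnabelianGeometry.AbsoluteAnabelian.AbsTopIII

end
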